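import Summits.NavierStokesRegularity.OSWSelfSimilar.SheetRSpectrumWindingLists
import Summits.NavierStokesRegularity.OSWSelfSimilar.SheetRResolventOddClass
import Literature.Analysis.OperatorTheory.PseudoResolventRankOneEigenvalue
import HarnessLib
/-!
# Sheet-ℝ spectral certificate (Z3-SR-SPEC, S2): the KERNEL ASSEMBLY, resolvent-keyed — from implementation 2's rectangle
# certificate to the eigenvalue census of `T + θℓ(·)f` on the open rectangle and the algebraic simplicity of `σ = 1`
HONEST FRAMING (cell ns-blowup GROUP B «PROFILE SEARCH»; PROFILE-SPEC v1.3 case Z3-SR-SPEC; 1-D MODEL (viscous gCLM/OSW sheet on `ℝ` at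
`(a, c_l, ε) = (1/5, 1/2, 1)`); computer-assisted; not Euler/NS; «violates: none — MODEL»; census hook
`Literature.Analysis.FluidPDE.effectiveViscosity_half`). Nothing here is a statement about Navier–Stokes. This file COMPOSES landed theorems;
it proves no new analysis and moves no number.
§1 (ABSTRACT, resolvent-keyed; `X` a complex Banach space, `J : ℂ → X →L[ℂ] X` a pseudo-resolvent on an open `U` containing the closed rectangle
`K = [−3/100, 12] × [−12, 12]` of `SheetRSpectrumWindingLists`, `ℓ : X →L[ℂ] ℂ`, `f : X`, `θ : ℂ`, Evans function `E(σ) = 1 − θ·ℓ(J σ f)`):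
from `IsPseudoResolvent.analyticOnNhd_evans` (`Literature…PseudoResolventRankOneEigenvalue`, Kato VIII-§1.1) `E` is analytic on `U ⊇ K`; from
`SheetRSpectrumWindingLists.eq_one_of_zero_and_order_one` (implementation 2's quadrant-label lists of record, `certTurns = 4`, the tree's
`Literature.Analysis.Complex.eq_of_winding_certificate`, Henrici §4.6/§4.10) the two NAMED HYPOTHESES «`RectLabelCertificate E`» (= implementation 2's
interval arithmetic: kit j270205 `s2_impl2.json` 94f123d366e47d6e + `rect_from_j270205.json` f71b02691bd71b8b) and «`E 1 = 0`» (= P-list (P6): `σ = 1` is an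
eigenvalue, the T-shift gauge mode — kernel on the profile side in cert-5's `SheetRTimeShiftMode*`, to be transported to `E 1 = 0` by
`IsPseudoResolvent.eigen_rankOne_iff` once the eigenvector is written in the resolvent's language) give: **(i)** `E σ ≠ 0` for every `σ ≠ 1` in the
open rectangle (`evans_ne_zero_of_ne_one`) and on its closed left edge `Re σ = −3/100` (`evans_ne_zero_leftEdge`); **(ii)** hence, by
`kernel_rankOne_iff_evans` / `eigen_rankOne_iff`, for such `σ` the rank-one–perturbed operator `T + θℓ(·)f` (`T = operatorOfResolvent J z₀`, Kato's
closed operator of the pseudo-resolvent) has NO eigenvector (`no_eigenvector_of_ne_one`, `eigen_eq_zero_of_ne_one`); **(iii)** `analyticOrderAt E 1 = 1`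
(`analyticOrderAt_evans_one`); **(iv)** hence, by `algebraicallySimple_of_analyticOrderAt_eq_one` (Kato III-§6.5 / IV-§1.4, elementary rank-one case),
`σ = 1` is a geometrically AND algebraically simple eigenvalue of `T + θℓ(·)f`: eigenvectors = the multiples of `J(1)f ≠ 0`, no Jordan chain (`simple_at_one`).
§2 (THE SHEET's ODD CLASS): `J := resolventOdd hL K h` (selfsim g12, `SheetRResolventOddClass`: the resolvent of the CLOSED operator `−A|_odd`,
`A = (−∂² + d∂ + V) + K`, on `Wcodd L = L²_{w,odd}(ℂ)`, an injective pseudo-resolvent on `{Re σ > −m}` for ANY Gårding datum `GardingDataKC … m`): for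
`3/100 < m` the rectangle lies in the half-plane and §1 applies verbatim (`sheet_evans_census`, `sheet_simple_at_one`, `sheet_eigen_eq_zero_of_ne_one`).
With cert-1's data (`K := −P + F`, i.e. `A = A_F = B_λ − P + F`; `m = c₁ + γ = 3/20` from S1; `θ = 4`; `f = h`, the 12 dyadics; `ℓ = ⟨h, ·⟩_w`) the
function `E` IS the Z3-SR-SPEC Evans function and `T + θℓ(·)f = −DG(Ω*)|_odd`; those identifications are NOT made in this file (they are the
one-screen successor step: write `ℓ`, `f` and (P6)'s eigenvector in the `Wcodd` language).
**What is NOT kernel-checked:** the truth of `RectLabelCertificate E` for the sheet (implementation 2's arithmetic) and of `E 1 = 0` ((P6) transport), the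
Gårding datum (S1, two arithmetics of record), the far field outside `K` (row `CertificateViscousSheetRSpectrumB`: zeros with `Re σ ≥ −3/100` have
`‖σ‖ ≤ R0B = 11.41`, inside `K` by `SheetRSpectrumWindingLists.halfDisc_subset_rect`). KERNEL: everything else named above.
-/

noncomputable section

namespace Summit.NavierStokesRegularity.OSWSelfSimilar
namespace SheetRSpectrumWindingAssembly

open Literature.Analysis.OperatorTheory Literature.Analysis.Complex SheetRSpectrumWindingLists Complex Set

/-! ### §1 Abstract, resolvent-keyed assembly -/
section Abstract

variable {X : Type*} [NormedAddCommGroup X] [NormedSpace ℂ X] [CompleteSpace X]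
variable {U : Set ℂ} {J : ℂ → X →L[ℂ] X}

/-- The Evans function of the rank-one perturbation `θℓ(·)f`, keyed on the resolvent family `J`: `E(σ) = 1 − θ·ℓ(J σ f)`. [folklore] -/
def evans (J : ℂ → X →L[ℂ] X) (ℓ : X →L[ℂ] ℂ) (f : X) (θ : ℂ) : ℂ → ℂ := fun σ => 1 - θ * ℓ (J σ f)

omit [CompleteSpace X] in
/-- Unfolding of `evans`. [folklore] -/
@[simp] theorem evans_apply (J : ℂ → X →L[ℂ] X) (ℓ : X →L[ℂ] ℂ) (f : X) (θ : ℂ) (σ : ℂ) :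
    evans J ℓ f θ σ = 1 - θ * ℓ (J σ f) := rfl

/-- `E` is analytic on a neighbourhood of every point of the closed rectangle `K ⊆ U`. [folklore] -/
theorem analyticOnNhd_evans_rect (h : IsPseudoResolvent U J) (hU : IsOpen U) (hKU : (Icc ra rb ×ℂ Icc rc rd) ⊆ U)
    (ℓ : X →L[ℂ] ℂ) (f : X) (θ : ℂ) : AnalyticOnNhd ℂ (evans J ℓ f θ) (Icc ra rb ×ℂ Icc rc rd) :=
  (h.analyticOnNhd_evans hU ℓ f θ).mono hKU

/-- **The census on the open rectangle (abstract):** under the rectangle certificate and `E 1 = 0`, `σ = 1` is the ONLY zero of `E` in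
`K° = (−3/100, 12) × (−12, 12)`, and `analyticOrderAt E 1 = 1`. [folklore] -/
theorem evans_census (h : IsPseudoResolvent U J) (hU : IsOpen U) (hKU : (Icc ra rb ×ℂ Icc rc rd) ⊆ U)
    (ℓ : X →L[ℂ] ℂ) (f : X) (θ : ℂ) (hcert : RectLabelCertificate (evans J ℓ f θ)) (h1 : evans J ℓ f θ 1 = 0) :
    (∀ σ ∈ Ioo ra rb ×ℂ Ioo rc rd, evans J ℓ f θ σ = 0 → σ = 1) ∧ analyticOrderAt (evans J ℓ f θ) 1 = 1 :=
  eq_one_of_zero_and_order_one (analyticOnNhd_evans_rect h hU hKU ℓ f θ) hcert h1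

/-- (i) `E σ ≠ 0` for every `σ ≠ 1` of the open rectangle. [folklore] -/
theorem evans_ne_zero_of_ne_one (h : IsPseudoResolvent U J) (hU : IsOpen U) (hKU : (Icc ra rb ×ℂ Icc rc rd) ⊆ U)
    (ℓ : X →L[ℂ] ℂ) (f : X) (θ : ℂ) (hcert : RectLabelCertificate (evans J ℓ f θ)) (h1 : evans J ℓ f θ 1 = 0)
    {σ : ℂ} (hσ : σ ∈ Ioo ra rb ×ℂ Ioo rc rd) (hne : σ ≠ 1) : evans J ℓ f θ σ ≠ 0 :=
  fun h0 => hne ((evans_census h hU hKU ℓ f θ hcert h1).1 σ hσ h0)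

omit [CompleteSpace X] in
/-- (i′) `E ≠ 0` on the closed LEFT EDGE `Re σ = −3/100`, `Im σ ∈ [−12, 12]` (every point lies on a certified piece) — needs only the certificate. [folklore] -/
theorem evans_ne_zero_leftEdge (ℓ : X →L[ℂ] ℂ) (f : X) (θ : ℂ) (hcert : RectLabelCertificate (evans J ℓ f θ))
    {y : ℝ} (hy : y ∈ Icc rc rd) : evans J ℓ f θ (ra + y * I) ≠ 0 :=
  hcert.left.ne_zero y (by simpa [leftRest_last] using hy) (by simp)

/-- (iii) `analyticOrderAt E 1 = 1`. [folklore] -/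
theorem analyticOrderAt_evans_one (h : IsPseudoResolvent U J) (hU : IsOpen U) (hKU : (Icc ra rb ×ℂ Icc rc rd) ⊆ U)
    (ℓ : X →L[ℂ] ℂ) (f : X) (θ : ℂ) (hcert : RectLabelCertificate (evans J ℓ f θ)) (h1 : evans J ℓ f θ 1 = 0) :
    analyticOrderAt (evans J ℓ f θ) 1 = 1 :=
  (evans_census h hU hKU ℓ f θ hcert h1).2

/-- (ii) For `σ ≠ 1` in the open rectangle there is NO `u ≠ 0` with `u = θℓ(u) • J(σ) f` — the resolvent form of «`σ` is not an eigenvalue of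
`T + θℓ(·)f`» (`kernel_rankOne_iff_evans`). [folklore] -/
theorem no_eigenvector_of_ne_one (h : IsPseudoResolvent U J) (hU : IsOpen U) (hKU : (Icc ra rb ×ℂ Icc rc rd) ⊆ U)
    (ℓ : X →L[ℂ] ℂ) (f : X) (θ : ℂ) (hcert : RectLabelCertificate (evans J ℓ f θ)) (h1 : evans J ℓ f θ 1 = 0)
    {σ : ℂ} (hσ : σ ∈ Ioo ra rb ×ℂ Ioo rc rd) (hne : σ ≠ 1) :
    ¬ ∃ u : X, u ≠ 0 ∧ u = (θ * ℓ u) • J σ f := fun hex =>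
  evans_ne_zero_of_ne_one h hU hKU ℓ f θ hcert h1 hσ hne ((IsPseudoResolvent.kernel_rankOne_iff_evans (J σ) ℓ f θ).1 hex)

/-- (ii′) The same in the language of Kato's closed operator `T = operatorOfResolvent J z₀` (`z₀ ∈ U`, `J z₀` injective): for `σ ≠ 1` in the open
rectangle, every `u ∈ dom T` with `T u = σu − θℓ(u) f` (i.e. `(T + θℓ(·)f) u = σ u`) is `0`. [folklore] -/
theorem eigen_eq_zero_of_ne_one (h : IsPseudoResolvent U J) (hU : IsOpen U) (hKU : (Icc ra rb ×ℂ Icc rc rd) ⊆ U)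
    {z₀ : ℂ} (hz₀ : z₀ ∈ U) {hinj : Function.Injective (J z₀)}
    (ℓ : X →L[ℂ] ℂ) (f : X) (θ : ℂ) (hcert : RectLabelCertificate (evans J ℓ f θ)) (h1 : evans J ℓ f θ 1 = 0)
    {σ : ℂ} (hσ : σ ∈ Ioo ra rb ×ℂ Ioo rc rd) (hne : σ ≠ 1) (u : X)
    (hu : ∃ hu : u ∈ (operatorOfResolvent J z₀ hinj).domain, operatorOfResolvent J z₀ hinj ⟨u, hu⟩ = σ • u - (θ * ℓ u) • f) :
    u = 0 := by
  have hσU : σ ∈ U := hKU ⟨Ioo_subset_Icc_self hσ.1, Ioo_subset_Icc_self hσ.2⟩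
  have heq := (h.eigen_rankOne_iff (hinj := hinj) hz₀ hσU ℓ f θ u).1 hu
  by_contra hu0
  exact no_eigenvector_of_ne_one h hU hKU ℓ f θ hcert h1 hσ hne ⟨u, hu0, heq⟩

/-- (iv) **`σ = 1` is a geometrically and algebraically SIMPLE eigenvalue of `T + θℓ(·)f`**: `J(1) f ≠ 0`; the solutions of
`T u = u − θℓ(u) f` are exactly the multiples of `J(1) f`; no eigenvector `δ₀ ≠ 0` has a generalized eigenvector `δ₁` with
`T δ₁ = δ₁ − θℓ(δ₁) f + δ₀` (`algebraicallySimple_of_analyticOrderAt_eq_one` on (iii)). [folklore] -/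
theorem simple_at_one (h : IsPseudoResolvent U J) (hU : IsOpen U) (hKU : (Icc ra rb ×ℂ Icc rc rd) ⊆ U)
    {z₀ : ℂ} (hz₀ : z₀ ∈ U) {hinj : Function.Injective (J z₀)}
    (ℓ : X →L[ℂ] ℂ) (f : X) (θ : ℂ) (hcert : RectLabelCertificate (evans J ℓ f θ)) (h1 : evans J ℓ f θ 1 = 0) :
    J 1 f ≠ 0 ∧
    (∀ u, (∃ hu : u ∈ (operatorOfResolvent J z₀ hinj).domain,
        operatorOfResolvent J z₀ hinj ⟨u, hu⟩ = (1 : ℂ) • u - (θ * ℓ u) • f) ↔ ∃ t : ℂ, u = t • J 1 f) ∧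
    ∀ δ₀, δ₀ ≠ 0 → (∃ hu : δ₀ ∈ (operatorOfResolvent J z₀ hinj).domain,
        operatorOfResolvent J z₀ hinj ⟨δ₀, hu⟩ = (1 : ℂ) • δ₀ - (θ * ℓ δ₀) • f) →
      ¬ ∃ δ₁, ∃ hu : δ₁ ∈ (operatorOfResolvent J z₀ hinj).domain,
        operatorOfResolvent J z₀ hinj ⟨δ₁, hu⟩ = (1 : ℂ) • δ₁ - (θ * ℓ δ₁) • f + δ₀ := by
  have h1U : (1 : ℂ) ∈ U := hKU ⟨Ioo_subset_Icc_self one_mem_rect.1, Ioo_subset_Icc_self one_mem_rect.2⟩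
  exact h.algebraicallySimple_of_analyticOrderAt_eq_one (hinj := hinj) hU hz₀ h1U ℓ f θ
    (analyticOrderAt_evans_one h hU hKU ℓ f θ hcert h1)

end Abstract

/-! ### §2 The sheet's odd class: `J = resolventOdd` -/
section Sheet

open SheetRResolventOddClass SheetROddClass SheetRComplexPivot SheetRPerturbedPair SheetRPerturbedResolventC SheetREnergySpace
  SheetRResolventIdentity

variable {L D₀ D₁ V₀ c m : ℝ} {d V : ℝ → ℝ}

/-- For a Gårding datum with `3/100 < m`, the closed rectangle lies in the resolvent half-plane `{Re σ > −m}`. [folklore] -/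
theorem rect_subset_halfPlane (hm : (3 : ℝ) / 100 < m) : (Icc ra rb ×ℂ Icc rc rd) ⊆ {σ : ℂ | -m < σ.re} := by
  intro σ hσ
  have h1 : ra ≤ σ.re := hσ.1.1
  simp only [mem_setOf_eq, ra] at h1 ⊢
  linarith

/-- **THE CENSUS FOR THE SHEET's ODD-CLASS RESOLVENT.** For ANY Gårding datum `h : GardingDataKC L hL d V K D₀ D₁ V₀ c m` with `3/100 < m`, any
`ℓ : Wcodd L →L[ℂ] ℂ`, `f : Wcodd L`, `θ : ℂ`, with `E(σ) = 1 − θ·ℓ(resolventOdd hL K h σ f)`: if `E` satisfies implementation 2's rectangle certificate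
and `E 1 = 0`, then `1` is the only zero of `E` in the open rectangle and `analyticOrderAt E 1 = 1`. (For cert-1's `K = −P + F`, `θ = 4`, `f = h`,
`ℓ = ⟨h, ·⟩_w`, `m = 3/20`: the Z3-SR-SPEC statement «no point spectrum of `−DG(Ω*)|_odd` in `K°` other than the simple gauge eigenvalue `1`».) [folklore] -/
theorem sheet_evans_census (hL : 0 < L) (K : Esp L hL →L[ℝ] W L) (h : GardingDataKC L hL d V K D₀ D₁ V₀ c m) (hm : (3 : ℝ) / 100 < m)
    (ℓ : Wcodd L →L[ℂ] ℂ) (f : Wcodd L) (θ : ℂ)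
    (hcert : RectLabelCertificate (evans (resolventOdd hL K h) ℓ f θ)) (h1 : evans (resolventOdd hL K h) ℓ f θ 1 = 0) :
    (∀ σ ∈ Ioo ra rb ×ℂ Ioo rc rd, evans (resolventOdd hL K h) ℓ f θ σ = 0 → σ = 1) ∧
      analyticOrderAt (evans (resolventOdd hL K h) ℓ f θ) 1 = 1 := by
  haveI : CompleteSpace (Wcodd L) := completeSpace_Wcodd L
  exact evans_census (isPseudoResolvent_resolventOdd hL K h) (isOpen_halfPlane m) (rect_subset_halfPlane hm) ℓ f θ hcert h1

/-- For the sheet: at every `σ ≠ 1` of the open rectangle, every `u ∈ dom T` with `T u = σu − θℓ(u) f`, `T = generatorOdd … 1` (Kato's closed operator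
of the odd-class resolvent, based at `z₀ = 1`), vanishes — no eigenvalue of `T + θℓ(·)f` in `K° ∖ {1}`. [folklore] -/
theorem sheet_eigen_eq_zero_of_ne_one (hL : 0 < L) (K : Esp L hL →L[ℝ] W L) (h : GardingDataKC L hL d V K D₀ D₁ V₀ c m)
    (hm : (3 : ℝ) / 100 < m) (ℓ : Wcodd L →L[ℂ] ℂ) (f : Wcodd L) (θ : ℂ)
    (hcert : RectLabelCertificate (evans (resolventOdd hL K h) ℓ f θ)) (h1 : evans (resolventOdd hL K h) ℓ f θ 1 = 0)
    {σ : ℂ} (hσ : σ ∈ Ioo ra rb ×ℂ Ioo rc rd) (hne : σ ≠ 1) (u : Wcodd L)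
    (hu : ∃ hu : u ∈ (operatorOfResolvent (resolventOdd hL K h) 1
        (injective_resolventOdd hL K h (σ := 1) (by simp only [one_re]; linarith))).domain,
      operatorOfResolvent (resolventOdd hL K h) 1 (injective_resolventOdd hL K h (σ := 1) (by simp only [one_re]; linarith)) ⟨u, hu⟩ =
        σ • u - (θ * ℓ u) • f) :
    u = 0 := by
  haveI : CompleteSpace (Wcodd L) := completeSpace_Wcodd L
  have h1U : (1 : ℂ) ∈ {σ : ℂ | -m < σ.re} := by simp only [mem_setOf_eq, one_re]; linarith
  exact eigen_eq_zero_of_ne_one (isPseudoResolvent_resolventOdd hL K h) (isOpen_halfPlane m) (rect_subset_halfPlane hm) h1U ℓ f θ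
    hcert h1 hσ hne u hu

/-- **For the sheet: `σ = 1` is a geometrically and algebraically simple eigenvalue of `T + θℓ(·)f`** (`T = generatorOdd … 1`): the resolvent vector
`resolventOdd 1 f ≠ 0` spans the eigenspace and admits no Jordan chain. [folklore] -/
theorem sheet_simple_at_one (hL : 0 < L) (K : Esp L hL →L[ℝ] W L) (h : GardingDataKC L hL d V K D₀ D₁ V₀ c m)
    (hm : (3 : ℝ) / 100 < m) (ℓ : Wcodd L →L[ℂ] ℂ) (f : Wcodd L) (θ : ℂ)
    (hcert : RectLabelCertificate (evans (resolventOdd hL K h) ℓ f θ)) (h1 : evans (resolventOdd hL K h) ℓ f θ 1 = 0) :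
    let hinj := injective_resolventOdd hL K h (σ := 1) (by simp only [one_re]; linarith)
    resolventOdd hL K h 1 f ≠ 0 ∧
    (∀ u, (∃ hu : u ∈ (operatorOfResolvent (resolventOdd hL K h) 1 hinj).domain,
        operatorOfResolvent (resolventOdd hL K h) 1 hinj ⟨u, hu⟩ = (1 : ℂ) • u - (θ * ℓ u) • f) ↔
          ∃ t : ℂ, u = t • resolventOdd hL K h 1 f) ∧
    ∀ δ₀, δ₀ ≠ 0 → (∃ hu : δ₀ ∈ (operatorOfResolvent (resolventOdd hL K h) 1 hinj).domain,
        operatorOfResolvent (resolventOdd hL K h) 1 hinj ⟨δ₀, hu⟩ = (1 : ℂ) • δ₀ - (θ * ℓ δ₀) • f) →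
      ¬ ∃ δ₁, ∃ hu : δ₁ ∈ (operatorOfResolvent (resolventOdd hL K h) 1 hinj).domain,
        operatorOfResolvent (resolventOdd hL K h) 1 hinj ⟨δ₁, hu⟩ = (1 : ℂ) • δ₁ - (θ * ℓ δ₁) • f + δ₀ := by
  intro hinj
  haveI : CompleteSpace (Wcodd L) := completeSpace_Wcodd L
  have h1U : (1 : ℂ) ∈ {σ : ℂ | -m < σ.re} := by simp only [mem_setOf_eq, one_re]; linarith
  exact simple_at_one (isPseudoResolvent_resolventOdd hL K h) (isOpen_halfPlane m) (rect_subset_halfPlane hm) h1U ℓ f θ hcert h1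

end Sheet

end SheetRSpectrumWindingAssembly
end Summit.NavierStokesRegularity.OSWSelfSimilar

end
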